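import Literature.AlgebraicGeometry.Frobenioids.IsoSubanchorNotIsotropic
import Literature.AlgebraicGeometry.Frobenioids.ArchimedeanTheoremsInstances
import Literature.AlgebraicGeometry.Frobenioids.ArchimedeanPseudoTerminal
import HarnessLib

/-!
# Frobenioids II, Proposition 3.5 (iv): a Frobenioid is not of RC-iso-subanchor type — PROVED

Mochizuki, *The geometry of Frobenioids II: poly-Frobenioids*, Kyushu J. Math. **62** (2008) 401–460,
§3, Proposition 3.5 (iv), kurims p. 34 (statement), pp. 35–36 (proof) [cite: MochizukiFrdII2008, Prop 3.5 (iv) p.34]: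

> (iv) `F` is not of RC-iso-subanchor type.

Printed proof (p. 35 l. 41 – p. 36 l. 4): if `F` were of RC-iso-subanchor type, a complex isotropic object
would be an RC-iso-subanchor, i.e. the target of a mono-minimal categorical quotient `B → A` from an
RC-subanchor `B`; by the isotropic-hull argument of [FrdI] Rem. 3.1.1 `B` is isotropic, hence (Def. 1.3
(vii)(b)) so is the RC-anchor `B'` receiving `B → B'`; but an isotropic object admits prime-Frobenius
morphisms of every prime degree, which are irreducible with pairwise non-isomorphic codomains ([FrdI]
Prop. 1.10 (iv)) — so `B'` is not an anchor of `F[ℂ]`, a contradiction.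

PROOF-ONLY companion (abc-iut cell, layer L1, DAG node `FrdII:Prop3.5(iv)` = SUBDAG S4 row P35-L07
`FNotRCIsoSubanchor`; seat abc-iut-w4-d027 on abc-iut-L1-t9's row offer 2026-08-25T23:45:49Z). We prove
the printed argument GENERICALLY — `PreFrobenioid.not_isOfRCIsoSubanchorType`: NO Frobenioid `F : C → F_Φ`
over a base `D` with ANY functor `P : D → D₀ = ArchBase` and at least one object is of RC-iso-subanchor type
(the complex object the printed proof starts from is PRODUCED by the hypothesis: any object is an
RC-iso-subanchor, whose RC-subanchor maps to an RC-anchor, which is complex; its isotropic hull is then a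
complex isotropic object) — and then instantiate abc-iut-L1-t9's schema `ArchFrd.Prop35iv`
(`ArchimedeanIsoSubanchors.lean`) and instances `ArchFrd.Prop35iv_C`, `ArchFrd.Prop35iv_A`
(`ArchimedeanTheoremsInstances.lean`):

* `ArchFrd.prop35iv_of_isFrobenioid` — the schema for every Frobenioid structure `F` on a nonempty
  category (the schema's antecedent "`D` of RC-iso-subanchor type" is not needed);
* `ArchFrd.prop35iv_C_of_isFrobenioid : IsFrobenioid (C.toElem π) → Nonempty D → Prop35iv_C π` and
  `ArchFrd.prop35iv_A_of_isFrobenioid : IsFrobenioid (A.toElem π) → Nonempty D → Prop35iv_A π` — the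
  printed claims for `F ∈ {C, A}` MODULO the Example 3.3 (ii)/(iii) named statements "`C` is a Frobenioid"
  / "`A` is a Frobenioid" (abc-iut-L1-t6's `Ex33ii_isFrobenioid` / `Ex33iii_isFrobenioid`, the layer's open
  deep rows; exactly the inputs the printed proof uses: (vii)(a)(b) isotropic hulls, (v)(a), (ii) Frobenius
  morphisms of every degree, Prop. 1.10 (iv)) and nonemptiness of the base `D` (print's standing "`D`
  connected"; for EMPTY `D` the categories `C`, `A` are empty, both sides of the schema are vacuous and
  `Prop35iv_C π` is FALSE — `ArchFrd.not_prop35iv_C_of_isEmpty`, a kernel note that the schema needs the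
  standing hypothesis, statement-level, LOW).

Inputs by name: `PreFrobenioid.IsIsotropicHull.exists_autHom` and the mono-minimality step of
`not_isIsotropic_of_isIsoSubanchor` ([FrdI] Rem. 3.1.1, `IsoSubanchorNotIsotropic.lean`),
`IsPrimeFrobenius.isIrreducibleHom` ([FrdI] Prop. 1.10 (iv), `FrobeniusTypePrime.lean`, seat abc-iut-L1-t1),
[FrdI] Rem. 1.1.1 (`degFr_comp`). No new definitions; no statement of the paper is strengthened (the
generic form is the printed proof, which never uses the hypothesis on `D`); nothing here bears on
[IUTchIII] Cor. 3.12.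
-/

namespace Literature.AlgebraicGeometry.Frobenioids

open CategoryTheory

universe w v v' u u' u₀ v₀

/-! ### `D₀ = ArchBase`: complexity along morphisms -/

namespace ArchBase

/-- A morphism `Spec K → Spec L` of `D₀` is a field embedding `L → K`, so `[L:ℝ] ≤ [K:ℝ]`.
[cite: MochizukiFrdII2008, Def 3.1 (i) p.23] -/
theorem finrank_le_of_hom {X Y : ArchBase} (f : X ⟶ Y) :
    Module.finrank ℝ Y ≤ Module.finrank ℝ X :=
  LinearMap.finrank_le_finrank_of_injective (f := f.alg.toLinearMap) f.alg.toRingHom.injective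

/-- If `Spec K → Spec L` and `L` is complex then `K` is complex (`[K:ℝ] ≤ 2` always). In particular
complexity is invariant under isomorphisms of `D₀`. [cite: MochizukiFrdII2008, Def 3.1 (v) p.24] -/
theorem isComplex_of_hom {X Y : ArchBase} (f : X ⟶ Y) (hY : IsComplex Y) : IsComplex X := by
  have h1 := finrank_le_of_hom f
  rcases isReal_or_isComplex X with hX | hX
  · unfold IsReal at hX
    unfold IsComplex at hY
    omega
  · exact hX

end ArchBase

namespace PreFrobenioid

variable {D : Type u} [Category.{v} D] {Φ : Dᵒᵖ ⥤ CommMonCat.{w}}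
  {C : Type u'} [Category.{v'} C] {F : C ⥤ ElemFrobenioid Φ}

/-- The mono-minimality step of [FrdI] Rem. 3.1.1 (p. 57), isolated: if `f : B → A` is a mono-minimal
categorical quotient of `B` by `G ⊆ Aut(B)` in a Frobenioid and `A` is isotropic, then `B` is isotropic
(`f` factors through the isotropic hull `B → B₁`, a monomorphism on which `G` acts compatibly, so the hull is
an isomorphism). [cite: MochizukiFrdI2008, Rem. 3.1.1 p.57] -/
theorem isIsotropic_of_isMonoMinimalQuotient (hF : IsFrobenioid F) {A B : C} {G : Subgroup (Aut B)}
    {f : B ⟶ A} (hmm : IsMonoMinimalQuotient G f) (hA : IsIsotropic F A) : IsIsotropic F B := by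
  obtain ⟨B₁, h, hh⟩ := hF.vii_a B
  haveI : Mono h := hF.v_a h hh.2.1
  obtain ⟨f', hf', -⟩ := hh.2.2.2 f hA
  obtain ⟨ρ, hρ⟩ := IsIsotropicHull.exists_autHom hh
  have hρinj : Function.Injective ρ := by
    intro γ γ' e
    have := hρ γ
    rw [e, ← hρ γ'] at this
    ext
    exact (cancel_mono h).mp this
  haveI hiso : IsIso h :=
    hmm.2 h f' hf' inferInstance
      ⟨G.map ρ, G.equivMapOfInjective ρ hρinj, fun γ => by
        rw [Subgroup.coe_equivMapOfInjective_apply]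
        exact hρ γ⟩
  exact hF.vii_b (inv h) hh.2.2.1

variable (P : D ⥤ ArchBase)

/-- Complexity (with respect to `C → D → D₀`) is transported along a base-isomorphism.
[cite: MochizukiFrdII2008, Def 3.1 (v) p.24] -/
theorem complexObjects_of_isBaseIso {A B : C} (φ : A ⟶ B) (hφ : IsBaseIso F φ)
    (hA : RC.complexObjects (baseFunctor F ⋙ P) A) : RC.complexObjects (baseFunctor F ⋙ P) B := by
  haveI : IsIso (Base F φ) := hφ
  have e : P.obj (baseObj F B) ⟶ P.obj (baseObj F A) := P.map (inv (Base F φ))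
  exact ArchBase.isComplex_of_hom e hA

/-- An irreducible arrow of `C` between complex objects is irreducible in the full subcategory `C[ℂ]`
(the inclusion is fully faithful and reflects isomorphisms). [cite: MochizukiFrdI2008, §0 p.17] -/
theorem isIrreducibleHom_homMk {Q : ObjectProperty C} {X Y : C} (hX : Q X) (hY : Q Y) {φ : X ⟶ Y}
    (h : IsIrreducibleHom φ) :
    IsIrreducibleHom (Q.homMk φ : (⟨X, hX⟩ : Q.FullSubcategory) ⟶ ⟨Y, hY⟩) := by
  refine ⟨fun hiso => h.1 ?_, fun Z β α hβα => ?_⟩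
  · exact (ObjectProperty.isIso_hom_iff (Q.homMk φ : (⟨X, hX⟩ : Q.FullSubcategory) ⟶ ⟨Y, hY⟩)).mpr hiso
  · have h' : β.hom ≫ α.hom = φ := congrArg InducedCategory.Hom.hom hβα
    rcases h.2 β.hom α.hom h' with hα | hβ
    · exact Or.inl ((ObjectProperty.isIso_hom_iff α).mp hα)
    · exact Or.inr ((ObjectProperty.isIso_hom_iff β).mp hβ)

/-- **[FrdI] Prop. 1.10 (iv) inside `C[ℂ]`**: an isotropic complex object of a Frobenioid is not an anchor
of the full subcategory of complex objects — the prime-Frobenius morphisms of each prime degree `p` out of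
it have complex codomains, are irreducible in `C[ℂ]`, and give pairwise non-isomorphic objects under it
(Rem. 1.1.1: degrees are multiplicative and isomorphisms have degree `1`).
[cite: MochizukiFrdI2008, Prop. 1.10(iv) p.34] -/
theorem not_isAnchor_complexPart_of_isIsotropic (hF : IsFrobenioid F) {A : C}
    (hA : RC.complexObjects (baseFunctor F ⋙ P) A) (hiso : IsIsotropic F A) :
    ¬ IsAnchor (⟨A, hA⟩ : RC.ComplexPart (baseFunctor F ⋙ P)) := by
  have hex : ∀ p : ℕ+, ∃ (B : C) (φ : A ⟶ B), IsFrobeniusType F φ ∧ degFr F φ = p :=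
    fun p => hF.ii_exists A p
  choose B φ hφ hφd using hex
  let Q : ObjectProperty C := RC.complexObjects (baseFunctor F ⋙ P)
  have hB : ∀ p, Q (B p) := fun p => complexObjects_of_isBaseIso P (φ p) (hφ p).2 hA
  let A' : Q.FullSubcategory := ⟨A, hA⟩
  let B' : ℕ+ → Q.FullSubcategory := fun p => ⟨B p, hB p⟩
  let φ' : ∀ p : ℕ+, A' ⟶ B' p := fun p => Q.homMk (φ p)
  intro hanch
  let g : ℕ → Quotient (isIsomorphicSetoid (Under A')) :=
    fun n => Quotient.mk _ (Under.mk (φ' (Nat.toPNat' n)))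
  refine Set.infinite_of_injOn_mapsTo (f := g) (s := {p : ℕ | p.Prime}) ?_ ?_
    Nat.infinite_setOf_prime hanch
  · intro p hp q hq hpq
    obtain ⟨e⟩ := Quotient.exact hpq
    let i : B' (Nat.toPNat' p) ≅ B' (Nat.toPNat' q) := (Under.forget A').mapIso e
    have hw : φ' (Nat.toPNat' p) ≫ i.hom = φ' (Nat.toPNat' q) := Under.w e.hom
    have hw' : φ (Nat.toPNat' p) ≫ i.hom.hom = φ (Nat.toPNat' q) :=
      congrArg InducedCategory.Hom.hom hw
    have hd := congrArg (degFr F) hw'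
    rw [degFr_comp, isLinear_of_isIso F i.hom.hom, mul_one, hφd, hφd] at hd
    have := congrArg (fun x : ℕ+ => (x : ℕ)) hd
    simpa [Nat.toPNat'_coe, hp.pos, hq.pos] using this
  · intro p hp
    refine ⟨Under.mk (φ' (Nat.toPNat' p)), ?_, rfl⟩
    have hprime : IsPrimeFrobenius F (φ (Nat.toPNat' p)) := by
      refine ⟨hφ _, ?_⟩
      rw [hφd, Nat.toPNat'_coe, if_pos hp.pos]
      exact hp
    exact isIrreducibleHom_homMk hA (hB _) (hprime.isIrreducibleHom hF hiso)

/-- **[FrdII] Prop. 3.5 (iv), generic form — PROVED**: a Frobenioid with at least one object is never of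
RC-iso-subanchor type with respect to `C → D → D₀`, whatever the functor `P : D → D₀`. (Printed proof,
pp. 35–36: an RC-anchor exists and is complex; its isotropic hull `A` is complex isotropic; `A` is the
mono-minimal quotient of an RC-subanchor `B`, which is then isotropic; the RC-anchor `B'` receiving
`B → B'` is isotropic, contradicting Prop. 1.10 (iv) in `C[ℂ]`.) [cite: MochizukiFrdII2008, Prop 3.5 (iv) p.34] -/
theorem not_isOfRCIsoSubanchorType (hF : IsFrobenioid F) [Nonempty C] :
    ¬ RC.IsOfRCIsoSubanchorType (baseFunctor F ⋙ P) := by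
  intro h
  obtain ⟨A₀⟩ := ‹Nonempty C›
  -- some RC-anchor `C₀`, necessarily complex
  obtain ⟨B₀, -, -, ⟨C₀, ⟨hC₀, -⟩, -⟩, -⟩ := h.isRCIsoSubanchor A₀
  -- its isotropic hull `A`: complex and isotropic
  obtain ⟨A, hull, hh⟩ := hF.vii_a C₀
  have hA : RC.complexObjects (baseFunctor F ⋙ P) A := complexObjects_of_isBaseIso P hull hh.2.1.2 hC₀
  -- `A` is an RC-iso-subanchor: `f : B → A` mono-minimal, `B → B'` with `B'` an RC-anchor
  obtain ⟨B, G, f, ⟨B', ⟨hB', hanch⟩, ⟨g⟩⟩, hmm⟩ := h.isRCIsoSubanchor A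
  have hBiso : IsIsotropic F B := isIsotropic_of_isMonoMinimalQuotient hF hmm hh.2.2.1
  have hB'iso : IsIsotropic F B' := hF.vii_b g hBiso
  exact not_isAnchor_complexPart_of_isIsotropic P hF hB' hB'iso hanch

end PreFrobenioid

namespace ArchFrd

/-- **[FrdII] Prop. 3.5 (iv)**, the schema `Prop35iv G F` of abc-iut-L1-t9 for EVERY Frobenioid structure
`F` on a nonempty category (its antecedent "`D` of RC-iso-subanchor type" is not used).
[cite: MochizukiFrdII2008, Prop 3.5 (iv) p.34] -/
theorem prop35iv_of_isFrobenioid {D : Type u} [Category.{v} D] (G : D ⥤ ArchBase)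
    {Φ : Dᵒᵖ ⥤ CommMonCat.{w}} {X : Type u'} [Category.{v'} X] (F : X ⥤ ElemFrobenioid Φ)
    (hF : PreFrobenioid.IsFrobenioid F) [Nonempty X] : Prop35iv G F :=
  fun _ => PreFrobenioid.not_isOfRCIsoSubanchorType G hF

variable {D : Type u₀} [Category.{v₀} D] (π : D ⥤ D0)

/-- A nonempty base gives a nonempty `C` (the tip-`1` isotropic object over any `B ∈ Ob(D)`).
[cite: MochizukiFrdII2008, Ex 3.3 (ii) p.28] -/
theorem C.nonempty_of_nonempty [Nonempty D] : Nonempty (C π) :=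
  ⟨unitObjOver π (Classical.arbitrary D)⟩

/-- A nonempty base gives a nonempty `A`. [cite: MochizukiFrdII2008, Ex 3.3 (iii) p.28] -/
theorem A.nonempty_of_nonempty [Nonempty D] : Nonempty (A π) :=
  ⟨⟨unitObjOver π (Classical.arbitrary D)⟩⟩

/-- **[FrdII] Prop. 3.5 (iv) for `F = C`** (instance `Prop35iv_C` of abc-iut-L1-t9), MODULO Ex. 3.3 (ii)
"`C` is a Frobenioid" (the layer's open deep row `Ex33ii_isFrobenioid`; hypothesis `hF`) and over a nonempty
base `D` (print: `D` connected): `C` is not of RC-iso-subanchor type. [cite: MochizukiFrdII2008, Prop 3.5 (iv) p.34] -/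
theorem prop35iv_C_of_isFrobenioid (hF : PreFrobenioid.IsFrobenioid (C.toElem π)) [Nonempty D] :
    Literature.AlgebraicGeometry.Frobenioids.ArchFrd.Prop35iv_C π :=
  haveI := C.nonempty_of_nonempty π
  prop35iv_of_isFrobenioid (baseRC π) (C.toElem π) hF

/-- **[FrdII] Prop. 3.5 (iv) for `F = A`** (instance `Prop35iv_A`), MODULO Ex. 3.3 (iii) "`A` is a
Frobenioid" (`Ex33iii_isFrobenioid`; hypothesis `hF`) and over a nonempty base: the angular Frobenioid `A`
is not of RC-iso-subanchor type. [cite: MochizukiFrdII2008, Prop 3.5 (iv) p.34] -/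
theorem prop35iv_A_of_isFrobenioid (hF : PreFrobenioid.IsFrobenioid (A.toElem π)) [Nonempty D] :
    Literature.AlgebraicGeometry.Frobenioids.ArchFrd.Prop35iv_A π :=
  haveI := A.nonempty_of_nonempty π
  prop35iv_of_isFrobenioid (baseRC π) (A.toElem π) hF

/-- Kernel note on the schema's standing hypothesis (statement-level, LOW): over an EMPTY base `D` the
categories `D`, `C` are empty, "of RC-iso-subanchor type" holds vacuously for both, and the instance
`Prop35iv_C π` is FALSE — print's standing "`D` connected" (hence nonempty) is load-bearing for (iv).
[cite: MochizukiFrdII2008, Prop 3.5 (iv) p.34] -/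
theorem not_prop35iv_C_of_isEmpty [IsEmpty D] :
    ¬ Literature.AlgebraicGeometry.Frobenioids.ArchFrd.Prop35iv_C π := by
  intro h
  have hD : RC.IsOfRCIsoSubanchorType (baseRC π) := ⟨fun d => (IsEmpty.false d).elim⟩
  exact h hD ⟨fun X => (IsEmpty.false X.snd).elim⟩

end ArchFrd

end Literature.AlgebraicGeometry.Frobenioids
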